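import Summits.CriticalPhenomena.PercolationContinuityZ3.Theses.PercNearOneGluing
import Literature.Probability.Percolation.PercolationProofs
import Literature.Probability.Percolation.ConditionalPositiveAssociationProofs
import Literature.Probability.Percolation.TwoClusterConditionalAssociationProofs
import Summits.CriticalPhenomena.PercolationContinuityZ3.Theorems.PercNearOneGluingAdditiveGluingGoodBase
import Summits.CriticalPhenomena.PercolationContinuityZ3.Theorems.PercNearOneGluingAdditiveGluingGoodTwoRelays
import Summits.CriticalPhenomena.PercolationContinuityZ3.Theorems.PercNearOneGluingAdditiveGluingLemma5AnyRelay
import Summits.CriticalPhenomena.PercolationContinuityZ3.Theorems.PercNearOneGluingAdditiveGluingGoodStep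
import Summits.CriticalPhenomena.PercolationContinuityZ3.Theorems.PercNearOneGluingAdditiveGluingPocketBHKStep

/-! TTRL-lite variant V2 of stmt-CriticalPhenomena-4576 -/

namespace Summit.CriticalPhenomena.PercolationContinuityZ3.Theorems

open MeasureTheory Literature.Probability.LatticeModels Literature.Probability.Percolation
open scoped Classical BigOperators

/-- **TTRL-lite variant V2 of `stmt-CriticalPhenomena-4576`** (seed = the registered stub
`stub_pocketDisjoint_k9`): the base case `X ∩ Y = ∅` of the pocket-augmented
van den Berg–Häggström–Kahn inequality — for product weights `w` of total mass `1`, `o ∈ U`, every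
forbidden set `X`, every pocket predicate `P` and every increasing `G ≥ 0` of the open edge cluster of
`s` in `G[U]`, `E[1_F 1{s ↮ X}] · E[G] ≤ E[1_F G] · P(s ↮ X)` with `F = {o ↔ s} ∪ {C(o) ∈ P}`.
This is literally the tree theorem `stub_pocketDisjoint_k9` (file `…PocketBHKStep.lean`,
`PocketBHK.disj0`). [folklore] -/
theorem stub_pocketDisjoint_k9_var2 : ∀ (V : Type) [Fintype V] (w : Sym2 V → ℝ), (∀ e, 0 ≤ w e) → (∀ e, w e ≤ 1) → ∑ ω, Literature.Probability.Percolation.BHK2006.weight w ω = 1 → ∀ (U : Finset V) (s o : V), o ∈ U → ∀ (X : Set V) (P : Set V → Prop) (G : Set (Sym2 V) → ℝ), Monotone G → (∀ a, 0 ≤ G a) → (∑ ω, Literature.Probability.Percolation.BHK2006.weight w ω * (Literature.Probability.Percolation.DecisionTree.ind {ξ : Set (Sym2 V) | (Literature.Probability.Percolation.openGraph (ξ ∩ Literature.Probability.Percolation.BHK2006.edgesIn U)).Reachable o s ∨ P (Literature.Probability.Percolation.openCluster (ξ ∩ Literature.Probability.Percolation.BHK2006.edgesIn U) o)} ω * Literature.Probability.Percolation.DecisionTree.ind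 (Literature.Probability.Percolation.BHK2006.rD U s X) ω)) * (∑ ω, Literature.Probability.Percolation.BHK2006.weight w ω * G (Literature.Probability.Percolation.BHK2006.rC U s ω)) ≤ (∑ ω, Literature.Probability.Percolation.BHK2006.weight w ω * (Literature.Probability.Percolation.DecisionTree.ind {ξ : Set (Sym2 V) | (Literature.Probability.Percolation.openGraph (ξ ∩ Literature.Probability.Percolation.BHK2006.edgesIn U)).Reachable o s ∨ P (Literature.Probability.Percolation.openCluster (ξ ∩ Literature.Probability.Percolation.BHK2006.edgesIn U) o)} ω * G (Literature.Probability.Percolation.BHK2006.rC U s ω))) * (∑ ω, Literature.Probability.Percolation.BHK2006.weight w ω * Literature.Probability.Percolation.DecisionTree.ind (Literature.Probability.Percolation.BHK2006.rD U s X) ω) :=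
  fun V _ w hw0 hw1 hm U s o hoU X P G hG hG0 =>
    stub_pocketDisjoint_k9 V w hw0 hw1 hm U s o hoU X P G hG hG0

end Summit.CriticalPhenomena.PercolationContinuityZ3.Theorems
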